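/-
Copyright (c) 2026 the pub-hodgecm-mathlib formalisation cell (harness21).  Prover seat hodgecm-mathlib-K2-defs1 (g4), Track B ∕ K2-LIT,
h413 = `stmt-HodgeConjecture-24833`, line `K2_E1_TraceFormulaBeta`, page «EIS-RANK-ONE», deal «(D2-g) E-LAYER MASS» of the dealer K2E1-plan (g4) 2026-09-04T07:02:32Z:
the E-layer envelope masses `h𝓔iE` ∕ `h𝓔NE` of (D2-e)-B (★ p858125) for `𝓔 = C·H^σ`, `σ > 2`, uniformly on `K_U`.
-/
import Summits.HodgeConjecture.HodgeConjecture.Theorems.K2E1EisensteinMinusConstantTermBoundedCMThree   -- ★ p858097 (this seat): brings ★ [D8] p857898, ★ (ν-1) p857963, ★ (ν-2) p857935, ★ Godement CM three, ★ `hfin_of_locallyUniformMajorant`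
import HarnessLib

/-!
# h413 ∕ Track B «K2-LIT», «EIS-RANK-ONE» (D2-g) — `K2E1CentreAverageMassU3`: the E-layer mass of the centre-line envelope,
# `X ↦ ∫_{𝔸_F} H(ι(w₀)·u(X, θ t)·g)^σ dμ_F ∈ L¹(𝔸_E)` (`σ > 2`), and its `K_U`-uniform double integral

Cell `pub/hodgecm-mathlib`, crux H413 = `stmt-HodgeConjecture-24833`, route `HCCMUnconditional`; dealer K2E1-plan (g4), deal «(D2-g)» 07:02:32Z (RULING «CONSTANTS-FIRST»
07:06:19Z observed: the mass `NE` is bound BEFORE `k`).  THEOREMS ONLY (no `def`, no `instance`, no `notation`, no named-fact hypothesis, no `sorry`); lane `--kind proof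
--supports stmt-HodgeConjecture-24833 --as helper` (count-neutral).

THE POINT.  Edition B ★ p858125 `exists_bound_sub_borelConstantTerm_level_cm_three_of_archSmooth` carries the E-layer envelope letters of ★ PART II p857895
(`h𝓔iE : ∀ k ∈ K_U, Integrable (X ↦ ∫ t, 𝓔(ι(w₀)·u(X,θt)·k) dμ_F) μ_E`, `h𝓔NE : ∀ k ∈ K_U, ∫_X ∫_t 𝓔(…) ≤ NE`).  For the envelope of a flat section, `𝓔 = C·H^σ` with
`σ = Re z > 2`, the double integral `∫_X ∫_t H(ι(w₀)·u(X, θ t)·g)^σ dμ_F dμ_E` is — up to Haar normalisation — the absolutely convergent INTERTWINING INTEGRAL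
`∫_{N(𝔸)} H(ι(w₀)·v·g)^σ dν(v)` of ★ [D8] `integrable_borelHeight_weylLongU_mul_rpow` (Godement ∕ Gindikin–Karpelevich range `σ > 2`), read through the Heisenberg chart
by ★ (ν-1) `integrable_comp_heisChart_traceZeroLine_prod_iff_three` and Fubini (`Integrable.integral_prod_left`); it is `K_U`-invariant in `g` because `H` is (★
`borelHeight_mul_of_mem_comap_standardMaximalCompactGL`), so ONE `NE` (the value at `g = 1`) serves all `k ∈ K_U`.

* §1 (generic quadratic pair) `integral_integral_centreLine_borelHeight_rpow_mul_eq_of_mem` — `∫_X∫_t H(…·k)^σ = ∫_X∫_t H(…)^σ` for `k ∈ K_U` (no integrability needed), and the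
  CONSTANTS-FIRST mass letter `exists_forall_integral_integral_centreLine_const_mul_borelHeight_rpow_le` — `∃ NE, ∀ k ∈ K_U, ∫_X ∫_t C·H(…·k)^σ ≤ NE` (= `h𝓔NE` of ★ B for
  `𝓔 := fun y => C * (H y : ℝ)^σ`).
* §2 (CM pair, `2 < σ`) **`integrable_centreAverageMass_borelHeight_rpow_cm_three`** — `Integrable (X ↦ ∫ t, H(ι(w₀)·u(X,θt)·g)^σ dμ_F) μ_E` for EVERY `g` (★ [D8] at
  `z := σ` + ★ (ν-2) inversion invariance + ★ Godement CM three for the constant section's `hfin` + ★ (ν-1) chart-side test + Fubini), and the letter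
  **`integrable_centreAverageMass_const_mul_cm_three`** (= `h𝓔iE` of ★ B for `𝓔 := fun y => C * (H y : ℝ)^σ`, all `k ∈ K_U`).
HONEST LABEL.  Count-neutral helper; proves no printed statement; HC_CM is proved only modulo the 7 printed citations (2 remaining named inputs: hLiu418 =
`stmt-HodgeConjecture-24832`, h413 = `stmt-HodgeConjecture-24833`) until rung 0 closes.

## References
* [MoeglinWaldspurger1995] C. Mœglin, J.-L. Waldspurger, *Spectral decomposition and Eisenstein series* (1995), II.1.6–II.1.7 (convergence of intertwining integrals), I.2.10.
* [Garrett2018] P. Garrett, *Modern Analysis of Automorphic Forms by Example* 1 (2018), §2.9, §3.11.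
* [Rogawski1990] J. D. Rogawski, *Automorphic Representations of Unitary Groups in Three Variables* (1990), §7.3 (p. 97).
-/

set_option autoImplicit false
set_option linter.dupNamespace false  -- the mandated namespace repeats the summit's segment (`HodgeConjecture.HodgeConjecture`)

noncomputable section

open MeasureTheory Measure Filter Topology NumberField IsDedekindDomain MulAction Module
open Literature.NumberTheory.Automorphic Literature.NumberTheory.Automorphic.UnitaryGroup
open Summit.HodgeConjecture.HodgeConjecture.Cruxes.H413.K2E1BorelEisensteinU
open Summit.HodgeConjecture.HodgeConjecture.Cruxes.H413.K2E1UnipotentHaarNormalisationU3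
open Summit.HodgeConjecture.HodgeConjecture.Cruxes.H413.K2E1HeisenbergHaarU3
open Summit.HodgeConjecture.HodgeConjecture.Cruxes.H413.K2E1IntertwiningGrowthU3
open Summit.HodgeConjecture.HodgeConjecture.Cruxes.H413.K2E1BorelEisensteinGodementCMThree
open Summit.HodgeConjecture.HodgeConjecture.Cruxes.H413.K2E1EisensteinAnalyticBinders
open scoped ENNReal NNReal

namespace Summit.HodgeConjecture.HodgeConjecture.Cruxes.H413.K2E1CentreAverageMassU3

/-! ## §1 `K_U`-invariance of the double integral and the CONSTANTS-FIRST mass letter (generic quadratic pair) -/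

section Generic

variable {F E : Type} [Field F] [NumberField F] [Field E] [NumberField E] [Algebra F E] [Algebra.IsQuadraticExtension F E] {c : E ≃ₐ[F] E} {δ : E}
  [MeasurableSpace (AdeleRing (𝓞 F) F)] [MeasurableSpace (AdeleRing (𝓞 E) E)]

/-- **`∫_X ∫_t H(ι(w₀)·u(X,θt)·k)^σ = ∫_X ∫_t H(ι(w₀)·u(X,θt))^σ` for `k ∈ K_U`** — the Borel height is right-`K_U`-invariant (★ `borelHeight_mul_of_mem_comap_standardMaximalCompactGL`);
no integrability is needed (equality of integrands). [cite: MoeglinWaldspurger1995, I.2.10] -/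
theorem integral_integral_centreLine_borelHeight_rpow_mul_eq_of_mem (hc : c * c = 1) (hcδ : c δ = -δ) (hδ : δ ≠ 0)
    (μF : Measure (AdeleRing (𝓞 F) F)) (μE : Measure (AdeleRing (𝓞 E) E)) (σ : ℝ)
    {k : (quasiSplit F E c 3).Adelic} (hk : k ∈ ((standardMaximalCompactGL 3 E).comap (adelicVal F E c 3 ((StdForm.antidiagonal 3).over E)) : Subgroup (quasiSplit F E c 3).Adelic)) :
    ∫ X, ∫ t, ((borelHeight (((quasiSplit F E c 3).toAdelic (weylLongU (c : E →+* E) (rfl : ((StdForm.antidiagonal 3).over E) = ((StdForm.antidiagonal 3).over E)))) * ((heisChart hc (X, traceZeroLine F E c hcδ hδ t) : ↥(adelicUnipotent F E c 3)) : (quasiSplit F E c 3).Adelic) * k) : ℝ)) ^ σ ∂μF ∂μE = ∫ X, ∫ t, ((borelHeight (((quasiSplit F E c 3).toAdelic (weylLongU (c : E →+* E) (rfl : ((StdForm.antidiagonal 3).over E) = ((StdForm.antidiagonal 3).over E)))) * ((heisChart hc (X, traceZeroLine F E c hcδ hδ t) : ↥(adelicUnipotent F E c 3)) : (quasiSplit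 F E c 3).Adelic)) : ℝ)) ^ σ ∂μF ∂μE := by
  simp_rw [borelHeight_mul_of_mem_comap_standardMaximalCompactGL hk]

/-- **The `h𝓔NE` letter of ★ B p858125 for `𝓔 := fun y => C * (H y : ℝ)^σ`, CONSTANTS-FIRST**: `∃ NE, ∀ k ∈ K_U, ∫_X ∫_t C·H(ι(w₀)·u(X,θt)·k)^σ dμ_F dμ_E ≤ NE` — with
`NE` the (`k`-free) value at `k = 1` (§1 invariance; equality, in fact). [cite: MoeglinWaldspurger1995, I.2.10, II.1.7] -/
theorem exists_forall_integral_integral_centreLine_const_mul_borelHeight_rpow_le (hc : c * c = 1) (hcδ : c δ = -δ) (hδ : δ ≠ 0)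
    (μF : Measure (AdeleRing (𝓞 F) F)) (μE : Measure (AdeleRing (𝓞 E) E)) (C σ : ℝ) :
    ∃ NE : ℝ, ∀ k ∈ ((standardMaximalCompactGL 3 E).comap (adelicVal F E c 3 ((StdForm.antidiagonal 3).over E)) : Subgroup (quasiSplit F E c 3).Adelic),
      ∫ X, ∫ t, (fun y : (quasiSplit F E c 3).Adelic => C * ((borelHeight y : ℝ)) ^ σ) (((quasiSplit F E c 3).toAdelic (weylLongU (c : E →+* E) (rfl : ((StdForm.antidiagonal 3).over E) = ((StdForm.antidiagonal 3).over E)))) * ((heisChart hc (X, traceZeroLine F E c hcδ hδ t) : ↥(adelicUnipotent F E c 3)) : (quasiSplit F E c 3).Adelic) * k) ∂μF ∂μE ≤ NE := by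
  refine ⟨∫ X, ∫ t, C * ((borelHeight (((quasiSplit F E c 3).toAdelic (weylLongU (c : E →+* E) (rfl : ((StdForm.antidiagonal 3).over E) = ((StdForm.antidiagonal 3).over E)))) * ((heisChart hc (X, traceZeroLine F E c hcδ hδ t) : ↥(adelicUnipotent F E c 3)) : (quasiSplit F E c 3).Adelic)) : ℝ)) ^ σ ∂μF ∂μE, fun k hk => le_of_eq ?_⟩
  simp_rw [borelHeight_mul_of_mem_comap_standardMaximalCompactGL hk]

end Generic

/-! ## §2 Integrability of the centre-line mass on `𝔸_E` (CM pair, `σ > 2`) -/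

section CM

variable (L : Type) [Field L] [NumberField L] [IsCMField L]
  [MeasurableSpace (quasiSplit (↥(maximalRealSubfield L)) L (IsCMField.complexConj L) 3).Adelic] [BorelSpace (quasiSplit (↥(maximalRealSubfield L)) L (IsCMField.complexConj L) 3).Adelic]
  [MeasurableSpace (AdeleRing (𝓞 L) L)] [BorelSpace (AdeleRing (𝓞 L) L)]
  [MeasurableSpace (AdeleRing (𝓞 ↥(maximalRealSubfield L)) ↥(maximalRealSubfield L))] [BorelSpace (AdeleRing (𝓞 ↥(maximalRealSubfield L)) ↥(maximalRealSubfield L))]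

/-- **THE E-LAYER MASS IS FINITE: `X ↦ ∫_{𝔸_{L⁺}} H(ι(w₀)·u(X, θ t)·g)^σ dμ_F` IS `μ_E`-INTEGRABLE for every `g` and every `σ > 2`** (CM pair).  The intertwining integral
`∫_{N(𝔸)} H(ι(w₀)·v·g)^σ dν(v)` converges absolutely for `σ > 2` (★ [D8] `integrable_borelHeight_weylLongU_mul_rpow` at `z := σ`, its `hfin` for the constant section from ★
`exists_locallyUniform_majorant_flatSectionU_cm_three` via ★ `hfin_of_locallyUniformMajorant`, `[ν.IsInvInvariant]` from ★ (ν-2)); transported to `𝔸_E × 𝔸_F` by ★ (ν-1)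
`integrable_comp_heisChart_traceZeroLine_prod_iff_three` and fibred by Fubini (`Integrable.integral_prod_left`). [cite: MoeglinWaldspurger1995, II.1.6–II.1.7] [cite: Garrett2018, §3.11] -/
theorem integrable_centreAverageMass_borelHeight_rpow_cm_three {δ : L} (hc : IsCMField.complexConj L * IsCMField.complexConj L = 1)
    (hcδ : IsCMField.complexConj L δ = -δ) (hδ : δ ≠ 0)
    (ν : Measure ↥(adelicUnipotent ↥(maximalRealSubfield L) L (IsCMField.complexConj L) 3)) [ν.IsHaarMeasure]
    {𝓕 : Set ↥(adelicUnipotent ↥(maximalRealSubfield L) L (IsCMField.complexConj L) 3)} (h𝓕 : IsFundamentalDomain ↥(rationalUnipotent ↥(maximalRealSubfield L) L (IsCMField.complexConj L) 3) 𝓕 ν) (h𝓕c : IsCompact (closure 𝓕))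
    (μF : Measure (AdeleRing (𝓞 ↥(maximalRealSubfield L)) ↥(maximalRealSubfield L))) [μF.IsAddHaarMeasure] (μE : Measure (AdeleRing (𝓞 L) L)) [μE.IsAddHaarMeasure]
    {σ : ℝ} (hσ : 2 < σ) (g : (quasiSplit (↥(maximalRealSubfield L)) L (IsCMField.complexConj L) 3).Adelic) :
    Integrable (fun X : AdeleRing (𝓞 L) L => ∫ t, ((borelHeight (((quasiSplit (↥(maximalRealSubfield L)) L (IsCMField.complexConj L) 3).toAdelic (weylLongU ((IsCMField.complexConj L : L ≃ₐ[↥(maximalRealSubfield L)] L) : L →+* L) (rfl : ((StdForm.antidiagonal 3).over L) = ((StdForm.antidiagonal 3).over L)))) * ((heisChart hc (X, traceZeroLine ↥(maximalRealSubfield L) L (IsCMField.complexConj L) hcδ hδ t) : ↥(adelicUnipotent ↥(maximalRealSubfield L) L (IsCMField.complexConj L) 3)) : (quasiSplit (↥(maximalRealSubfield L)) L (IsCMField.complexConj L) 3).Adelic) * g) : ℝ)) ^ σ ∂μF) μE := by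
  haveI := isInvInvariant_of_isHaarMeasure_adelicUnipotent_three hc ν
  haveI := locallyCompactSpace_adeleRing' L
  haveI := locallyCompactSpace_adeleRing' ↥(maximalRealSubfield L)
  haveI := secondCountableTopology_adeleRing L
  haveI := secondCountableTopology_adeleRing ↥(maximalRealSubfield L)
  have hz : 2 < ((σ : ℂ)).re := by rwa [Complex.ofReal_re]
  -- `hfin` for the constant flat section (★ Godement at the CM pair), then ★ [D8]
  have hmaj₁ := fun y₀ : (quasiSplit (↥(maximalRealSubfield L)) L (IsCMField.complexConj L) 3).Adelic =>
    exists_locallyUniform_majorant_flatSectionU_cm_three L hz (φ := fun _ : (quasiSplit (↥(maximalRealSubfield L)) L (IsCMField.complexConj L) 3).Adelic => (1 : ℂ)) (M := 1) (fun _ => le_of_eq norm_one) y₀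
  have hfB₁ := flatSectionU_toAdelic_mul (c := IsCMField.complexConj L) (N := 3) (φ := fun _ : (quasiSplit (↥(maximalRealSubfield L)) L (IsCMField.complexConj L) 3).Adelic => (1 : ℂ)) (fun _ _ _ => rfl) (σ : ℂ)
  have hcont₁ : ∀ q : Quotient (orbitRel ↥(borelU ((IsCMField.complexConj L : L ≃ₐ[↥(maximalRealSubfield L)] L) : L →+* L) ((StdForm.antidiagonal 3).over L)) ↥(unitaryGroupOfForm ((IsCMField.complexConj L : L ≃ₐ[↥(maximalRealSubfield L)] L) : L →+* L) ((StdForm.antidiagonal 3).over L))),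
      Continuous fun y : (quasiSplit (↥(maximalRealSubfield L)) L (IsCMField.complexConj L) 3).Adelic => flatSectionU (fun _ : (quasiSplit (↥(maximalRealSubfield L)) L (IsCMField.complexConj L) 3).Adelic => (1 : ℂ)) (σ : ℂ) ((quasiSplit (↥(maximalRealSubfield L)) L (IsCMField.complexConj L) 3).toAdelic (q.out : ↥(unitaryGroupOfForm ((IsCMField.complexConj L : L ≃ₐ[↥(maximalRealSubfield L)] L) : L →+* L) ((StdForm.antidiagonal 3).over L))) * y) :=
    fun q => (continuous_flatSectionU continuous_const _).comp (continuous_const.mul continuous_id)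
  have hD8 := integrable_borelHeight_weylLongU_mul_rpow ν h𝓕 (σ : ℂ) g (hfin_of_locallyUniformMajorant ν hfB₁ hcont₁ hmaj₁ h𝓕c g)
  -- to `ℂ`, through the chart (★ (ν-1)), Fubini, back to `ℝ`
  have hT0 : Integrable (fun v : ↥(adelicUnipotent ↥(maximalRealSubfield L) L (IsCMField.complexConj L) 3) => ((borelHeight (((quasiSplit (↥(maximalRealSubfield L)) L (IsCMField.complexConj L) 3).toAdelic (weylLongU ((IsCMField.complexConj L : L ≃ₐ[↥(maximalRealSubfield L)] L) : L →+* L) (rfl : ((StdForm.antidiagonal 3).over L) = ((StdForm.antidiagonal 3).over L)))) * (v : (quasiSplit (↥(maximalRealSubfield L)) L (IsCMField.complexConj L) 3).Adelic) * g) : ℝ)) ^ σ) ν :=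
    hD8.congr (Eventually.of_forall fun v => by simp only [Complex.ofReal_re, mul_assoc])
  have hprod := (integrable_comp_heisChart_traceZeroLine_prod_iff_three hcδ hδ hc μF μE ν
    (fun v : ↥(adelicUnipotent ↥(maximalRealSubfield L) L (IsCMField.complexConj L) 3) => ((((borelHeight (((quasiSplit (↥(maximalRealSubfield L)) L (IsCMField.complexConj L) 3).toAdelic (weylLongU ((IsCMField.complexConj L : L ≃ₐ[↥(maximalRealSubfield L)] L) : L →+* L) (rfl : ((StdForm.antidiagonal 3).over L) = ((StdForm.antidiagonal 3).over L)))) * (v : (quasiSplit (↥(maximalRealSubfield L)) L (IsCMField.complexConj L) 3).Adelic) * g) : ℝ)) ^ σ : ℝ) : ℂ))).2 hT0.ofReal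
  refine (hprod.re.integral_prod_left).congr (Eventually.of_forall fun X => ?_)
  simp only [RCLike.re_to_complex, Complex.ofReal_re]

/-- **The `h𝓔iE` letter of ★ B p858125 for `𝓔 := fun y => C * (H y : ℝ)^σ`** (`σ > 2`, CM pair): `∀ k ∈ K_U, Integrable (X ↦ ∫ t, C·H(ι(w₀)·u(X,θt)·k)^σ dμ_F) μ_E` (§2 for
`g := k`, `integral_const_mul`). [cite: MoeglinWaldspurger1995, II.1.6–II.1.7] -/
theorem integrable_centreAverageMass_const_mul_cm_three {δ : L} (hc : IsCMField.complexConj L * IsCMField.complexConj L = 1)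
    (hcδ : IsCMField.complexConj L δ = -δ) (hδ : δ ≠ 0)
    (ν : Measure ↥(adelicUnipotent ↥(maximalRealSubfield L) L (IsCMField.complexConj L) 3)) [ν.IsHaarMeasure]
    {𝓕 : Set ↥(adelicUnipotent ↥(maximalRealSubfield L) L (IsCMField.complexConj L) 3)} (h𝓕 : IsFundamentalDomain ↥(rationalUnipotent ↥(maximalRealSubfield L) L (IsCMField.complexConj L) 3) 𝓕 ν) (h𝓕c : IsCompact (closure 𝓕))
    (μF : Measure (AdeleRing (𝓞 ↥(maximalRealSubfield L)) ↥(maximalRealSubfield L))) [μF.IsAddHaarMeasure] (μE : Measure (AdeleRing (𝓞 L) L)) [μE.IsAddHaarMeasure]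
    (C : ℝ) {σ : ℝ} (hσ : 2 < σ) :
    ∀ k ∈ ((standardMaximalCompactGL 3 L).comap (adelicVal ↥(maximalRealSubfield L) L (IsCMField.complexConj L) 3 ((StdForm.antidiagonal 3).over L)) : Subgroup (quasiSplit (↥(maximalRealSubfield L)) L (IsCMField.complexConj L) 3).Adelic),
      Integrable (fun X : AdeleRing (𝓞 L) L => ∫ t, (fun y : (quasiSplit (↥(maximalRealSubfield L)) L (IsCMField.complexConj L) 3).Adelic => C * ((borelHeight y : ℝ)) ^ σ) (((quasiSplit (↥(maximalRealSubfield L)) L (IsCMField.complexConj L) 3).toAdelic (weylLongU ((IsCMField.complexConj L : L ≃ₐ[↥(maximalRealSubfield L)] L) : L →+* L) (rfl : ((StdForm.antidiagonal 3).over L) = ((StdForm.antidiagonal 3).over L)))) * ((heisChart hc (X, traceZeroLine ↥(maximalRealSubfield L) L (IsCMField.complexConj L) hcδ hδ t) : ↥(adelicUnipotent ↥(maximalRealSubfield L) L (IsCMField.complexConj L) 3)) : (quasiSplit (↥(maximalRealSubfield L)) L (IsCMField.complexConj L) 3).Adelic) * k) ∂μF) μE := by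
  intro k _
  have h := (integrable_centreAverageMass_borelHeight_rpow_cm_three L hc hcδ hδ ν h𝓕 h𝓕c μF μE hσ k).const_mul C
  refine h.congr (Eventually.of_forall fun X => ?_)
  exact (integral_const_mul C _).symm

end CM

end Summit.HodgeConjecture.HodgeConjecture.Cruxes.H413.K2E1CentreAverageMassU3

end
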